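import Mathlib
import HarnessLib
import HarnessLib.Audit
import Summits.ABC.ABC.Theses.TwistAmplification

/-!
# Line `deep-moduli-cusp-dispersion` — crux `TwistAmplification.SharpModerateLaw` (stmt-ABC-1975)

Skeleton of the line, generation 2 (crux-plan, planner-cruxplan-stmt-ABC-1975-deep-moduli-cusp-dis-g2-0, 2026-08-16),
superseding the gen-1 skeleton of the same path (planner …-dis-0, 5 stubs registered 2026-08-16T00:29Z). Inputs: the
triaged crux idea `Cruxes/SharpModerateLaw/Ideas/deep-moduli-cusp-dispersion.md` (3/3 pass), TRIAGE-r1-1, TRIAGE-r1-2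
(gen 2, incl. toys T2/T5), TRIAGE-r1-3, the standing disprover's PUBLISHED `Cruxes/SharpModerateLaw/Disproof.lean` (v7a)
and its gen-1 hypothesis audit (ledger notes), the census jobs j008131/j008140 (this seat).

THE CRUX. `SharpModerateLaw`: for `3 < κ < 6 < σ`, `ε > 0`, the number of reduced minimal integral models with
`c₄c₆ ≠ 0`, conductor `N ≤ X` and `N^κ ≤ M⁺ = max(|Δ|, |c₄|³) ≤ N^σ` is `≤ C X^{1−κ/6+ε}`.

THE TRANSFER TARGET C⁺′ (`CuspLawD`, the panel's repaired C⁺; verbatim the gen-1 typing). Over `ℤ²`: for `σ > 6`,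
`ε > 0` there is `C` with, for all `X, Y ≥ 1`, `X³/8 ≤ Y ≤ X^σ`, `#cuspSetD(X,Y) ≤ C X^ε (X·Y^{-1/6} + 1)`, where
`cuspSetD X Y` = pairs `(u,v) = (c₄,c₆)` with `uv ≠ 0`, `u³ ≠ v²` (CUSP EXCISED), `1728 ∣ u³ − v²`, tower-free (`TF`),
`|u|³ ≤ Y`, `|u³−v²| ≤ 1728Y`, the dyadic floor `Y < 2·max(|u|³, |u³−v²|/1728)` and conductor proxy
`N*(u,v) = ∏_{p ∣ Δ} (p² if p ∣ u else p) ≤ X`. At `Y = X^s` the law `X·Y^{-1/6}` is `X^{1−s/6}` on the nose.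

WHAT CHANGED FROM GEN 1, AND WHY (g2 findings, NOTES.md of this seat):
(1) `simpleRad ≤ Nstar ≤ X ≤ 2Y^{1/3}` on the whole range `X³ ≤ 8Y` (lemma `simpleRad_le_Nstar` below, PROVED): every
    prime `p ∥ u³ − v²` is `≥ 5`, divides `Δ`, and is charged `≥ p` in `N*`. Hence gen-1's `stub_trivialRegime`
    (`r' ≥ Y^{1/2}`) is an EMPTY regime for `Y > 64` — a vacuous stub — and its "completion reaches `r' ≥ Y^{4/9}`" is an
    empty range too. It is dropped; the cover is Resolved ∨ Deep ∨ Hall. The corrected per-modulus picture: the deep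
    modulus always satisfies `e·g ≥ |u³−v²|/r' ≥ |u³−v²|/(2Y^{1/3})` (Szpiro depth is FORCED, the card's item 3), plain
    completion (error `√e ≥ Y^{1/3}·O(1)` against an expected count `≤ Y^{1/6}` per class) never suffices, the
    RESOLVED regime `r' ≥ Y^{1/6}` is exactly where OPTIMAL per-modulus cancellation in the incomplete dual sum would
    suffice (depth-aspect, sub-Pólya–Vinogradov: the `u`-length is `e^{1/2}` … `e^{2/5}`), and below it (DEEP) only the
    modulus average can pay.
(2) TRIAGE-r1-2 (g2) ran the card's falsifier (2): with BOX weights `|B(e)| ≍ e^{5/6}` coherently (no cancellation over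
    `e`) — the Poisson-dual image of the trivial cusp points `(w², w³)`. So cusp excision (`u³ ≠ v²`) AND the dyadic tube
    `|u³ − v²| ≍ Y'` BEFORE Poisson are load-bearing in every analytic stub (all three carry both clauses), and the honest
    dual problem is the one AFTER excision: stationary phase at `p` (`e(4h₁³·(27h₂²)⁻¹/e)`, stub 2) and at `∞`
    (`e(−4h₁³/(27h₂²e))`) combine by reciprocity into `e(−4h₁³·ē/(27h₂²))` — a Kloosterman fraction to the DUAL modulus
    `27h₂²` with the deep modulus `e` in the numerator; its average over the sparse family `{e powerful, rad e ≤ Q}` is the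
    content of the deep stub (TRIAGE-r1-3's barrier-candidate on ℓ²/variance methods bites exactly there).
(3) The lever's core identity is now its own provable stub (`stub_cuspStationaryPhase`: `|S(h₁,h₂;pⁿ)| ≤ 2p^{n/2}` for
    `p ≥ 5`, `n ≥ 2`, not both `p ∣ h₁, p ∣ h₂`; it is `0` in the degenerate cases and `p^{n/2}` otherwise — IK Lemmas
    12.2/12.3; NO Weil/Deligne input since the modulus is powerful) and is threaded as the hypothesis of the two dispersion
    stubs, which name the stub that consumes it.

THE FIVE STUBS (2 provable now, 3 open named bets; `sorry` only inside them):
* `stub_cuspTransfer`        — C⁺′ ⇒ crux (L, provable now; consumes H = `κ < 6`, minimality ⇒ `TF`, `N* ≤ conductorNorm`).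
* `stub_cuspStationaryPhase` — the complete cusp sums to prime-power moduli (M, provable now, elementary).
* `stub_resolvedRegime`      — stationary phase ⇒ the law on `{|u³−v²| > 1728√Y, r' ≥ Y^{1/6}}` (XL; at resolution;
                               depth-aspect q-van der Corput / p-adic second-derivative test territory).
* `stub_deepRegime`          — stationary phase ⇒ the law on `{|u³−v²| > 1728√Y, r' < Y^{1/6}}` (XL; below resolution;
                               the dispersion bet proper — HARDEST, load-bearing).
* `stub_hallRegime`          — the law on `{|u³−v²| ≤ 1728√Y}` (XL; the archimedean corner; signature = gen 1's).
Every regime law is C⁺′ restricted to a sub-family (implied by C⁺′); `SharpModerateLaw_of` composes them BY NAME over a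
kernel-checked union bound (no `sorry` outside the five `stub_*`).

Disproof.lean (published v8, 2026-08-16T01:12Z, + gen-1 v1–v6 audit on the ledger) honoured: `not_sharpModerateLawRadical`
(NEW §2: the crux with `N` replaced by `rad|Δ|` is FALSE — prime quadratic twists): every set here charges `p²` at `p ∣ u` in
`N*`, never a radical; H = `κ < 6` consumed in `stub_cuspTransfer`
(dyadic sum of the `+1` terms needs `1 − κ/6 > 0`; the N = 30 witness is one pair in one box); H = `c₄ ≠ 0`, `c₆ ≠ 0`:
`u ≠ 0 ∧ v ≠ 0` in every set (the `cmCurve`/`qtCurve` twist families lie outside all regime sets); H = minimality: `TF` in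
every set, derived from `IsMinimalAt` in the transfer (`freyScaled` violates `TF`); H = `0 < ε`: kept everywhere;
reducedness: used once (≤ 12-to-1 in the transfer; `sharpModerateLaw_without_reduced_trivial`); tightness
(`not_sharpModerateLaw_lowered`, `window_not_power_saving`): no stub goes below `X·Y^{-1/6}`; `window_finite` is mirrored
by `cuspSetD_finite`; v7a's `moderateWindowCount_of_sharpModerateLaw` is downstream of the crux (not used here). No
`Theorems/SharpModerateLaw/Negative/` lemma exists. Triage certificates (`TriageCexR1K2`: `not_CuspCountLaw`,
`not_IndexFormCensus`, `not_BoxRadicalLaw(')`; r1-3 `not_boxRadicalLaw`; the two `DeepModuliLevel` witnesses): answered by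
construction (dyadic floor, `N*` not a radical, `u³ ≠ v²`, no discrepancy statement, no free modulus scale).
`ledger negatives --problem ABC` (2 refutations, 1689/1205): unrelated to counting.
-/

set_option linter.dupNamespace false

namespace Summit.ABC.ABC.Cruxes.SharpModerateLaw.DeepModuliCuspDispersion

open scoped BigOperators

/-! ## The objects of C⁺′ (verbatim gen 1 / `Ideator2Sketch`) -/

/-- Tower-freeness: the divisibility pattern that a model minimal at every prime cannot have
(`p ≥ 5`: `p⁴ ∣ c₄ ∧ p⁶ ∣ c₆`; at 2: `2⁸ ∣ c₄ ∧ 2¹¹ ∣ c₆`; at 3: `3⁵ ∣ c₄ ∧ 3⁹ ∣ c₆`). -/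
def TF (x : ℤ × ℤ) : Prop :=
  (∀ p : ℕ, p.Prime → 5 ≤ p → ¬ ((p : ℤ) ^ 4 ∣ x.1 ∧ (p : ℤ) ^ 6 ∣ x.2)) ∧
  ¬ ((2 : ℤ) ^ 8 ∣ x.1 ∧ (2 : ℤ) ^ 11 ∣ x.2) ∧ ¬ ((3 : ℤ) ^ 5 ∣ x.1 ∧ (3 : ℤ) ^ 9 ∣ x.2)

/-- Conductor proxy `N*(c₄,c₆) = ∏_{p ∣ Δ} (p² if p ∣ c₄ else p)`, `Δ = (c₄³ − c₆²)/1728`; on a minimal model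
`N* ≤ conductorNorm` (`p ∣ Δ`, `p ∤ c₄`: multiplicative, `f_p = 1`; `p ∣ Δ`, `p ∣ c₄`: additive, `f_p ≥ 2`). -/
def Nstar (x : ℤ × ℤ) : ℕ :=
  ∏ p ∈ ((x.1 ^ 3 - x.2 ^ 2) / 1728).natAbs.primeFactors, (if ((p : ℕ) : ℤ) ∣ x.1 then p ^ 2 else p)

/-- The DYADIC cusp set at scales `(X, Y)`: pairs `(u,v) = (c₄,c₆)` with `uv ≠ 0`, `u³ ≠ v²`, `1728 ∣ u³ − v²`,
tower-free, `M⁺ := max(|u|³, |u³−v²|/1728) ∈ (Y/2, Y]` and `N* ≤ X`. -/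
def cuspSetD (X Y : ℝ) : Set (ℤ × ℤ) :=
  {x | x.1 ≠ 0 ∧ x.2 ≠ 0 ∧ x.1 ^ 3 ≠ x.2 ^ 2 ∧ (1728 : ℤ) ∣ x.1 ^ 3 - x.2 ^ 2 ∧ TF x ∧
    ((|x.1| ^ 3 : ℤ) : ℝ) ≤ Y ∧ ((|x.1 ^ 3 - x.2 ^ 2| : ℤ) : ℝ) ≤ 1728 * Y ∧
    Y < 2 * max (((|x.1| ^ 3 : ℤ) : ℝ)) (((|x.1 ^ 3 - x.2 ^ 2| : ℤ) : ℝ) / 1728) ∧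
    (Nstar x : ℝ) ≤ X}

/-- **C⁺′ = `CuspLawD`**, the transfer target: `#cuspSetD(X,Y) ≤ C_{σ,ε} X^ε (X·Y^{-1/6} + 1)` for
`X, Y ≥ 1`, `X³/8 ≤ Y ≤ X^σ`, every `σ > 6`. -/
def CuspLawD : Prop :=
  ∀ σ : ℝ, 6 < σ → ∀ ε : ℝ, 0 < ε → ∃ C : ℝ, ∀ X Y : ℝ, 1 ≤ X → 1 ≤ Y → X ^ 3 ≤ 8 * Y → Y ≤ X ^ σ →
    (Set.ncard (cuspSetD X Y) : ℝ) ≤ C * X ^ ε * (X * Y ^ (-(1 / 6 : ℝ)) + 1)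

/-- The SIMPLE RADICAL `r'(u,v) = ∏_{p ∥ u³ − v²} p` (primes dividing `u³ − v²` exactly once; automatically `p ≥ 5`,
`p ∤ u`, multiplicative of type `I₁`). `|u³ − v²|/r'` carries all the depth (the dispersion modulus `e`, powerful and
prime to `u`) and all the additive primes. In the crux range `r' ≤ N* ≤ X ≤ 2Y^{1/3}` (`simpleRad_le_Nstar`). -/
def simpleRad (x : ℤ × ℤ) : ℕ :=
  ∏ p ∈ (x.1 ^ 3 - x.2 ^ 2).natAbs.primeFactors.filter (fun p : ℕ => ¬ (((p : ℕ) : ℤ) ^ 2 ∣ x.1 ^ 3 - x.2 ^ 2)), p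

/-! ## The three regimes (cover `regimes_cover`) -/

/-- HALL regime (archimedean corner): `|u³ − v²| ≤ 1728·Y^{1/2}`, i.e. `|Δ| ≤ Y^{1/2}`; with the dyadic floor this
forces `|u|³ > Y/2` and `||v| − u^{3/2}| < 2445`: integer points within `O(1)` of the real cusp, below archimedean
resolution (per `u` the `v`-count is `0/1`). -/
def HallRegime (Y : ℝ) (x : ℤ × ℤ) : Prop :=
  ((|x.1 ^ 3 - x.2 ^ 2| : ℤ) : ℝ) ≤ 1728 * Y ^ (1 / 2 : ℝ)

/-- RESOLVED regime: thick tube and `r' ≥ Y^{1/6}` — every modulus class expects `≳ 1` point (`R ≥ X^{s/6}` of the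
card's item 2); per-modulus estimates of optimal strength would suffice. (`r' ≤ 2Y^{1/3}` automatically.) -/
def ResolvedRegime (Y : ℝ) (x : ℤ × ℤ) : Prop :=
  ¬ (((|x.1 ^ 3 - x.2 ^ 2| : ℤ) : ℝ) ≤ 1728 * Y ^ (1 / 2 : ℝ)) ∧ Y ^ (1 / 6 : ℝ) ≤ (simpleRad x : ℝ)

/-- DEEP regime: thick tube and `r' < Y^{1/6}` — below resolution: `≍ X/r'` modulus classes each expecting `< 1`
point; only the average over the densely divisible modulus family can pay. -/
def DeepRegime (Y : ℝ) (x : ℤ × ℤ) : Prop :=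
  ¬ (((|x.1 ^ 3 - x.2 ^ 2| : ℤ) : ℝ) ≤ 1728 * Y ^ (1 / 2 : ℝ)) ∧ (simpleRad x : ℝ) < Y ^ (1 / 6 : ℝ)

/-- The law C⁺′ restricted to the pairs satisfying `P` (same constants shape, same right side). -/
def LawOn (P : ℝ → ℤ × ℤ → Prop) : Prop :=
  ∀ σ : ℝ, 6 < σ → ∀ ε : ℝ, 0 < ε → ∃ C : ℝ, ∀ X Y : ℝ, 1 ≤ X → 1 ≤ Y → X ^ 3 ≤ 8 * Y → Y ≤ X ^ σ →
    (Set.ncard {x : ℤ × ℤ | x ∈ cuspSetD X Y ∧ P Y x} : ℝ) ≤ C * X ^ ε * (X * Y ^ (-(1 / 6 : ℝ)) + 1)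

/-! ## The complete cusp sums (the lever's explicit stationary phase) -/

/-- `S(h₁,h₂;pⁿ) = Σ_{t ∈ (ℤ/pⁿ)ˣ} e((h₁t² + h₂t³)/pⁿ)`, the complete exponential sum along the parametrised cusp
`(t², t³)` that every Poisson/completion step modulo the deep modulus produces (by CRT the sum to a powerful modulus
`e = ∏ pᵢ^{nᵢ}`, all `nᵢ ≥ 2`, factors into these). -/
noncomputable def cuspSum (p n : ℕ) (h₁ h₂ : ℤ) : ℂ :=
  ∑ t ∈ (Finset.range (p ^ n)).filter (fun t : ℕ => Nat.Coprime t p),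
    Complex.exp (2 * (Real.pi : ℂ) * Complex.I * ((h₁ : ℂ) * (t : ℂ) ^ 2 + (h₂ : ℂ) * (t : ℂ) ^ 3) / (p : ℂ) ^ n)

/-- **Stationary phase for the cusp sums** (IK Lemmas 12.2–12.3): for `p ≥ 5` prime, `n ≥ 2` and `(h₁,h₂)` not both
divisible by `p`, `|S(h₁,h₂;pⁿ)| ≤ 2·p^{n/2}`. Truth: the critical points of `f = h₁t² + h₂t³` on units solve
`t(2h₁ + 3h₂t) ≡ 0`, i.e. `t₀ ≡ −2h₁(3h₂)⁻¹`; if `p ∣ h₁` or `p ∣ h₂` (not both) no unit is critical and `S = 0`;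
otherwise `t₀` is a nondegenerate unit critical point (`f''(t₀) = −2h₁`) and `|S| = p^{n/2}` exactly, with phase
`e(f(t₀)/pⁿ) = e(4h₁³·(27h₂²)⁻¹/pⁿ)` times a Gauss-sum sign for odd `n`. The factor 2 is slack. -/
def CuspSumBound : Prop :=
  ∀ p n : ℕ, p.Prime → 5 ≤ p → 2 ≤ n → ∀ h₁ h₂ : ℤ, ¬ ((p : ℤ) ∣ h₁ ∧ (p : ℤ) ∣ h₂) →
    ‖cuspSum p n h₁ h₂‖ ≤ 2 * (p : ℝ) ^ ((n : ℝ) / 2)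

/-! ## The five stub STATEMENTS (named; the registered `stub_*` theorems restate them verbatim over Mathlib + the
route decl, `Registered.stub_*` are the name-keyed aliases used as hypotheses of `SharpModerateLaw_of`) -/

/-- Statement of STUB 1, the TRANSFER: C⁺′ implies the crux. -/
def CuspTransfer : Prop :=
  CuspLawD → Summit.ABC.ABC.Theses.TwistAmplification.SharpModerateLaw

/-- Statement of STUB 2: the stationary-phase bound for the complete cusp sums. -/
def CuspStationaryPhase : Prop := CuspSumBound

/-- Statement of STUB 3: stationary phase ⇒ the law on the resolved regime. -/
def ResolvedRegimeLaw : Prop := CuspSumBound → LawOn ResolvedRegime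

/-- Statement of STUB 4: stationary phase ⇒ the law on the deep regime. -/
def DeepRegimeLaw : Prop := CuspSumBound → LawOn DeepRegime

/-- Statement of STUB 5: the law on the Hall regime. -/
def HallRegimeLaw : Prop := LawOn HallRegime

/-! ## The registered stubs (`sorry` lives only in these five theorems) -/

/-- **STUB 1 · `stub_cuspTransfer`** (the Transfer C⁺′ ⇒ crux; PROVABLE NOW; size L; algebraic number theory of
minimal models + dyadic bookkeeping; signature = gen 1's registered one). Given `3 < κ < 6 < σ`, `ε > 0`: cut the window
into dyadic shells `N ∈ (X'/2, X']`, `M⁺ ∈ (Y/2, Y]` (`X'³/8 ≤ (X'/2)^κ < Y ≤ X'^σ`), apply C⁺′ at `(X', Y)` with `σ+1`, and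
map `W₀ ↦ (c₄ W₀, c₆ W₀)`. (a) Image in `cuspSetD X' Y`: `c₄, c₆ ≠ 0` are crux clauses; `c₄³ − c₆² = 1728Δ ≠ 0`
(`WeierstrassCurve.c_relation`, `IsElliptic`); `TF` from `IsMinimalAt` is IN THE TREE, clause by clause:
`WeierstrassCurve.not_pow_dvd_c₄_c₆_of_isMinimalAt` (`p ≥ 5`), `…_two` (`2⁸, 2¹¹`), `…_three` (`3⁵, 3⁹`)
(`Literature/NumberTheory/EllipticCurves/SzpiroMinimalityProofs.lean`); `M⁺` agrees; `N*(c₄,c₆) ≤ conductorNorm` by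
`conductorExponent_eq_one_of_dvd_Δ_of_not_dvd_c₄` (multiplicative) and `two_le_conductorExponent_of_dvd_Δ_of_dvd_c₄`
(additive) with `factorization_conductorNorm_primesEquiv_symm` / `factorization_conductorNorm_holds`
(`…EllipticCurves/SzpiroLocalDataProofs.lean`, `…DiophantineGeometry/ConductorFactorizationProofs.lean`). (b) Multiplicity
≤ 12: `(a₁,a₂,a₃)` and `(c₄,c₆)` determine `(a₄,a₆)` (linear). (c) `Σ_{X',Y} 12 C X'^ε (X'Y^{-1/6} + 1) ≪ X^{1−κ/6+2ε}`
by geometric sums, `Y > (X'/2)^κ` and `1 − κ/6 > 0` — where H = `κ < 6` of the Disproof is consumed; finiteness of the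
window for the `ncard` arithmetic: `Disproof.window_finite` (published) or `cuspSetD_finite` below. -/
theorem stub_cuspTransfer :
    (∀ σ : ℝ, 6 < σ → ∀ ε : ℝ, 0 < ε → ∃ C : ℝ, ∀ X Y : ℝ, 1 ≤ X → 1 ≤ Y → X ^ 3 ≤ 8 * Y → Y ≤ X ^ σ →
      (Set.ncard {x : ℤ × ℤ | x.1 ≠ 0 ∧ x.2 ≠ 0 ∧ x.1 ^ 3 ≠ x.2 ^ 2 ∧ (1728 : ℤ) ∣ x.1 ^ 3 - x.2 ^ 2 ∧
          ((∀ p : ℕ, p.Prime → 5 ≤ p → ¬ ((p : ℤ) ^ 4 ∣ x.1 ∧ (p : ℤ) ^ 6 ∣ x.2)) ∧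
            ¬ ((2 : ℤ) ^ 8 ∣ x.1 ∧ (2 : ℤ) ^ 11 ∣ x.2) ∧ ¬ ((3 : ℤ) ^ 5 ∣ x.1 ∧ (3 : ℤ) ^ 9 ∣ x.2)) ∧
          ((|x.1| ^ 3 : ℤ) : ℝ) ≤ Y ∧ ((|x.1 ^ 3 - x.2 ^ 2| : ℤ) : ℝ) ≤ 1728 * Y ∧
          Y < 2 * max (((|x.1| ^ 3 : ℤ) : ℝ)) (((|x.1 ^ 3 - x.2 ^ 2| : ℤ) : ℝ) / 1728) ∧
          ((∏ p ∈ ((x.1 ^ 3 - x.2 ^ 2) / 1728).natAbs.primeFactors,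
              (if ((p : ℕ) : ℤ) ∣ x.1 then p ^ 2 else p) : ℕ) : ℝ) ≤ X} : ℝ) ≤
        C * X ^ ε * (X * Y ^ (-(1 / 6 : ℝ)) + 1)) →
      ∀ κ σ ε : ℝ, 3 < κ → κ < 6 → 6 < σ → 0 < ε → ∃ C : ℝ, ∀ X : ℝ, 1 ≤ X →
        (Set.ncard {W₀ : WeierstrassCurve ℤ | (W₀.baseChange ℚ).IsElliptic ∧
            (∀ v : IsDedekindDomain.HeightOneSpectrum ℤ, (W₀.baseChange ℚ).IsMinimalAt v) ∧
            (W₀.a₁ = 0 ∨ W₀.a₁ = 1) ∧ (W₀.a₃ = 0 ∨ W₀.a₃ = 1) ∧ (W₀.a₂ = -1 ∨ W₀.a₂ = 0 ∨ W₀.a₂ = 1) ∧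
            W₀.c₄ ≠ 0 ∧ W₀.c₆ ≠ 0 ∧ (((W₀.baseChange ℚ).conductorNorm ℤ : ℕ) : ℝ) ≤ X ∧
            (((W₀.baseChange ℚ).conductorNorm ℤ : ℕ) : ℝ) ^ κ ≤ ((max |W₀.Δ| (|W₀.c₄| ^ 3) : ℤ) : ℝ) ∧
            ((max |W₀.Δ| (|W₀.c₄| ^ 3) : ℤ) : ℝ) ≤ (((W₀.baseChange ℚ).conductorNorm ℤ : ℕ) : ℝ) ^ σ} : ℝ) ≤
          C * X ^ (1 - κ / 6 + ε) := by
  sorry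

/-- **STUB 2 · `stub_cuspStationaryPhase`** (PROVABLE NOW; size M; elementary). `|S(h₁,h₂;pⁿ)| ≤ 2p^{n/2}` for `p ≥ 5`
prime, `n ≥ 2`, `¬(p ∣ h₁ ∧ p ∣ h₂)` (statement `CuspSumBound`). Proof route (Iwaniec–Kowalski §12.3): write
`t = y + p^{n−1}z`; `f(t) ≡ f(y) + p^{n−1} z f'(y) (mod pⁿ)` for `n ≥ 2`, so `S = p·Σ_{y unit mod p^{n−1}, p ∣ f'(y)} e(f(y)/pⁿ)`
with `f'(y) = y(2h₁ + 3h₂y)`: no unit is critical when exactly one of `h₁, h₂` is divisible by `p` (`S = 0`); otherwise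
the unique critical class `t₀ ≡ −2h₁(3h₂)⁻¹ (mod p)` is nondegenerate (`f''(t₀) = −2h₁`, a unit as `p ≥ 5`) and lifts
uniquely (Hensel), giving `|S| = p^{n/2}` (even `n`: one term of modulus `p^{n/2}`; odd `n`: a quadratic Gauss sum of
modulus `√p`, Mathlib `gaussSum`/`quadraticChar`). Leans on: `ZMod`, `Finset.sum` over `range (p^n)`,
`Complex.exp` periodicity (`Complex.exp_periodic`-type lemmas), `ZMod.χ₄`/`quadraticChar` Gauss sums. Why a stub and
not glue: it is the line's load-bearing identity (the explicit phase `4h₁³/27h₂²` lives here) and both dispersion stubs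
consume it (they take it as their hypothesis). -/
theorem stub_cuspStationaryPhase :
    ∀ p n : ℕ, p.Prime → 5 ≤ p → 2 ≤ n → ∀ h₁ h₂ : ℤ, ¬ ((p : ℤ) ∣ h₁ ∧ (p : ℤ) ∣ h₂) →
      ‖∑ t ∈ (Finset.range (p ^ n)).filter (fun t : ℕ => Nat.Coprime t p),
          Complex.exp (2 * (Real.pi : ℂ) * Complex.I * ((h₁ : ℂ) * (t : ℂ) ^ 2 + (h₂ : ℂ) * (t : ℂ) ^ 3) /
            (p : ℂ) ^ n)‖ ≤ 2 * (p : ℝ) ^ ((n : ℝ) / 2) := by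
  sorry

/-- **STUB 3 · `stub_resolvedRegime`** (XL; AT RESOLUTION; open as stated, inside known technology classes).
Hypothesis: the stationary-phase bound of STUB 2 (verbatim). Conclusion: the law on
`{|u³−v²| > 1728Y^{1/2}, r' ≥ Y^{1/6}}`. Bookkeeping (notation: `u³ − v² = ±2^a3^b·r'·e·g`, `e` the powerful part prime
to `6u` = the dispersion MODULUS, on which `(u,v) ≡ (t²,t³)` with `t = v·u⁻¹` (`cuspParam`, proved below), `g` the
additive part `p ∣ u`): reduce to twist-minimal pairs `(u,v) = (d²u', d³v')` (`d` squarefree by `TF`; the law is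
twist-covariant, `(X,Y) ↦ (X/d², Y/d⁶)` maps `X·Y^{-1/6}` to itself `/d`; at primes `p ∣ d` already in `N*(u',v')` the
gain is `p` or `1` but such `p ∣ N*(u',v')`, a divisor condition visible at class level), so additive depth is bounded
(`v_p ≤ 10`) and densities are `≤ p·p^{-v_p}`; classes `(e, a = rad g)` with `rad(e)·a² ≤ 216X/r'`; class count
`#{e ≍ E powerful : rad e ≤ Q} ≤ C_ε Q (QE)^ε` (Rankin + divisor bound); per class the expected count is
`≍ φ(e)·area/e² ≥ r'·Y^{-1/6} ≥ 1`. SIZES in the crux range (`X ≤ 2Y^{1/3}`, `r' ≤ X`): `e ≥ |u³−v²|/(2Y^{1/3}g)`, so for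
the full box (`|Δ| ≍ Y`) `e ∈ [Y^{2/3}/2g, Y^{5/6}/g]`, `u`-length `U = Y^{1/3} ∈ [e^{2/5}, e^{1/2}]`, `v`-length
`Y^{1/2} ≤ e^{3/4}`: completion alone (error `√e·log²e` per class, via STUB 2 + CRT, against the expected
`Y^{5/6}/e`) loses by `Y^{1/6}…Y^{5/12}`; what is needed is cancellation of OPTIMAL strength in the incomplete dual sum,
`Σ_{h₁ ≤ H₁, h₂ ≤ H₂} Ŵ(h)·S(h₁,h₂;e) ≪ UV·(H₁H₂)^{1/2}·e^{1/2+o(1)}` (`H₁ = e/U`, `H₂ = e/V`), i.e. square-root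
cancellation in `(h₁,h₂)` of the explicit phases `e(4h₁³·(27h₂²)⁻¹/e)` — which suffices exactly down to `r' = Y^{1/6}`
(error `(UV)^{1/2}e^{-1/2}` = expected count there). The dual diagonal `27h₂² ∣ 4h₁³` (the image of the near-cusp
tube; TRIAGE-r1-2 toy T2 measured it only with BOX weights, where the cusp points make it `e^{5/6}`) must be shown
admissible after excision — the first thing to compute on this stub.
ENGINES: `e` is powerful with `rad e ≤ 216X/r' ≤ 216X^{1−s/6}` — depth aspect: p-adic van der Corput / second-derivative
test (Milićević arXiv:1407.4100; Blomer–Milićević doi:10.24033/asens.2252), q-vdC with the factorisations `e = e₁e₂` that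
dense divisibility supplies (Heath-Brown 1978; Polymath8a arXiv:1402.0811 §§6–8), Postnikov for characters mod `pⁿ`; for
thin tubes `Y^{1/2} < |Δ| < Y` the `u`-sum carries the archimedean phase `h₂u^{3/2}/e` as well (mixed stationary phase).
At the bottom (`r' ≈ Y^{1/6}`, expected `≈ 1` per class) a pointwise route needs near-optimal uniformity; a first modulus
average (`≍ X·Y^{-1/6}` classes available) is the fallback. Why the STATEMENT might fail: only with C⁺′ (it is C⁺′ on a
sub-family). -/
theorem stub_resolvedRegime :
    (∀ p n : ℕ, p.Prime → 5 ≤ p → 2 ≤ n → ∀ h₁ h₂ : ℤ, ¬ ((p : ℤ) ∣ h₁ ∧ (p : ℤ) ∣ h₂) →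
      ‖∑ t ∈ (Finset.range (p ^ n)).filter (fun t : ℕ => Nat.Coprime t p),
          Complex.exp (2 * (Real.pi : ℂ) * Complex.I * ((h₁ : ℂ) * (t : ℂ) ^ 2 + (h₂ : ℂ) * (t : ℂ) ^ 3) /
            (p : ℂ) ^ n)‖ ≤ 2 * (p : ℝ) ^ ((n : ℝ) / 2)) →
    ∀ σ : ℝ, 6 < σ → ∀ ε : ℝ, 0 < ε → ∃ C : ℝ, ∀ X Y : ℝ, 1 ≤ X → 1 ≤ Y → X ^ 3 ≤ 8 * Y → Y ≤ X ^ σ →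
      (Set.ncard {x : ℤ × ℤ | (x.1 ≠ 0 ∧ x.2 ≠ 0 ∧ x.1 ^ 3 ≠ x.2 ^ 2 ∧ (1728 : ℤ) ∣ x.1 ^ 3 - x.2 ^ 2 ∧
          ((∀ p : ℕ, p.Prime → 5 ≤ p → ¬ ((p : ℤ) ^ 4 ∣ x.1 ∧ (p : ℤ) ^ 6 ∣ x.2)) ∧
            ¬ ((2 : ℤ) ^ 8 ∣ x.1 ∧ (2 : ℤ) ^ 11 ∣ x.2) ∧ ¬ ((3 : ℤ) ^ 5 ∣ x.1 ∧ (3 : ℤ) ^ 9 ∣ x.2)) ∧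
          ((|x.1| ^ 3 : ℤ) : ℝ) ≤ Y ∧ ((|x.1 ^ 3 - x.2 ^ 2| : ℤ) : ℝ) ≤ 1728 * Y ∧
          Y < 2 * max (((|x.1| ^ 3 : ℤ) : ℝ)) (((|x.1 ^ 3 - x.2 ^ 2| : ℤ) : ℝ) / 1728) ∧
          ((∏ p ∈ ((x.1 ^ 3 - x.2 ^ 2) / 1728).natAbs.primeFactors,
              (if ((p : ℕ) : ℤ) ∣ x.1 then p ^ 2 else p) : ℕ) : ℝ) ≤ X) ∧
        (¬ (((|x.1 ^ 3 - x.2 ^ 2| : ℤ) : ℝ) ≤ 1728 * Y ^ (1 / 2 : ℝ)) ∧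
          Y ^ (1 / 6 : ℝ) ≤ ((∏ p ∈ (x.1 ^ 3 - x.2 ^ 2).natAbs.primeFactors.filter
              (fun p : ℕ => ¬ (((p : ℕ) : ℤ) ^ 2 ∣ x.1 ^ 3 - x.2 ^ 2)), p : ℕ) : ℝ))} : ℝ) ≤
        C * X ^ ε * (X * Y ^ (-(1 / 6 : ℝ)) + 1) := by
  sorry

/-- **STUB 4 · `stub_deepRegime`** (the LOAD-BEARING and HARDEST stub; XL; open). Hypothesis: STUB 2 verbatim.
Conclusion: the law on `{|u³−v²| > 1728Y^{1/2}, r' < Y^{1/6}}`: `u³ − v²` is (powerful prime to `6u`)·(additive)·`2^a3^b`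
up to a factor `r' < Y^{1/6}`, the classes `(e, a)` number `≍ X/r'` and each expects `< 1` point — BELOW RESOLUTION, no
per-modulus statement can give the law; only the average over `𝓔 = {e powerful : rad e ≤ 216X/(r'a²)}` (densely
divisible at every scale, size `≍ X/r' ≥ X·Y^{-1/6}`) can. THE HONEST DUAL PROBLEM (g2, after TRIAGE-r1-2's toy T2):
with the cusp excised and the tube `|u³−v²| ≍ Y'` dyadic, Poisson in `(u,v)` + STUB 2 at `p` + stationary phase at `∞`
give, per `(h₁,h₂)`, the phase `e(4h₁³·(27h₂²)⁻¹/e)·e(−4h₁³/(27h₂²e)) = e(−4h₁³·ē/(27h₂²))` (reciprocity): a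
Kloosterman FRACTION to the dual modulus `27h₂²` (`h₂ ≤ H₂ = eY^{1/2}/Y'`) with the deep modulus in the numerator as
`ē`; the needed saving over the orthogonality/ℓ² starting line `X^{1+5s/12}/r'` is square-root in `(h₁,h₂)` plus
`e^{1/12}r'^{1/12}` from the `e`-sum `Σ_{e ∈ 𝓔} e(−4h₁³ē/(27h₂²))` over a family of density `≤ E^{-1/2}` — where
TRIAGE-r1-3's barrier-candidate (ℓ²/variance bilinear bounds — large sieve, DFI, KMS arXiv:1511.01636, KSWX
arXiv:2204.05038 — save nothing on supports of density `≤ M^{-1/48}`) bites; the bet is the MULTIPLICATIVE structure of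
`𝓔` (`e = a²b³`, so `ē = ā²·b̄³` and `a` ranges over an interval whenever `rad e ≤ Q` is slack; factorisations `e = e₁e₂`
at every scale for q-vdC / Polymath8a Type I–II shapes, arXiv:1402.0811) together with the slack `X^{(6−s)/12}` of the
card's item 2 (the analysis is critical exactly at `s = 6`, consistent with `SzpiroEpsilonCannotBeDropped`). Deepest
sub-case `r'·g ≍ 1` (`u³ − v² = ±m·e`, `m` tiny): there `v + a√(−mb³) = (c + d√(−mb³))³` (cube classes of `ℚ(√(−mb³))`,
`u = c² + mb³d²`) turns the count into radical-smallness of `d(3c² − mb³d²)` over `(c,d)` — the coordinates of lines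
`three-descent-quadratic-roots` / `syzygy-lattice-half-deep-few-primes`, a bridge, not a dependency. Why the STATEMENT
might fail: only with C⁺′ (random-model law; Kane's deep-{3,5} pencils, every Davenport–Stothers / clean-Belyi family and
F3 of Disproof v7a sit ON it; F2: no polynomial family with ≤ 3 parameters beats it). -/
theorem stub_deepRegime :
    (∀ p n : ℕ, p.Prime → 5 ≤ p → 2 ≤ n → ∀ h₁ h₂ : ℤ, ¬ ((p : ℤ) ∣ h₁ ∧ (p : ℤ) ∣ h₂) →
      ‖∑ t ∈ (Finset.range (p ^ n)).filter (fun t : ℕ => Nat.Coprime t p),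
          Complex.exp (2 * (Real.pi : ℂ) * Complex.I * ((h₁ : ℂ) * (t : ℂ) ^ 2 + (h₂ : ℂ) * (t : ℂ) ^ 3) /
            (p : ℂ) ^ n)‖ ≤ 2 * (p : ℝ) ^ ((n : ℝ) / 2)) →
    ∀ σ : ℝ, 6 < σ → ∀ ε : ℝ, 0 < ε → ∃ C : ℝ, ∀ X Y : ℝ, 1 ≤ X → 1 ≤ Y → X ^ 3 ≤ 8 * Y → Y ≤ X ^ σ →
      (Set.ncard {x : ℤ × ℤ | (x.1 ≠ 0 ∧ x.2 ≠ 0 ∧ x.1 ^ 3 ≠ x.2 ^ 2 ∧ (1728 : ℤ) ∣ x.1 ^ 3 - x.2 ^ 2 ∧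
          ((∀ p : ℕ, p.Prime → 5 ≤ p → ¬ ((p : ℤ) ^ 4 ∣ x.1 ∧ (p : ℤ) ^ 6 ∣ x.2)) ∧
            ¬ ((2 : ℤ) ^ 8 ∣ x.1 ∧ (2 : ℤ) ^ 11 ∣ x.2) ∧ ¬ ((3 : ℤ) ^ 5 ∣ x.1 ∧ (3 : ℤ) ^ 9 ∣ x.2)) ∧
          ((|x.1| ^ 3 : ℤ) : ℝ) ≤ Y ∧ ((|x.1 ^ 3 - x.2 ^ 2| : ℤ) : ℝ) ≤ 1728 * Y ∧
          Y < 2 * max (((|x.1| ^ 3 : ℤ) : ℝ)) (((|x.1 ^ 3 - x.2 ^ 2| : ℤ) : ℝ) / 1728) ∧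
          ((∏ p ∈ ((x.1 ^ 3 - x.2 ^ 2) / 1728).natAbs.primeFactors,
              (if ((p : ℕ) : ℤ) ∣ x.1 then p ^ 2 else p) : ℕ) : ℝ) ≤ X) ∧
        (¬ (((|x.1 ^ 3 - x.2 ^ 2| : ℤ) : ℝ) ≤ 1728 * Y ^ (1 / 2 : ℝ)) ∧
          ((∏ p ∈ (x.1 ^ 3 - x.2 ^ 2).natAbs.primeFactors.filter
              (fun p : ℕ => ¬ (((p : ℕ) : ℤ) ^ 2 ∣ x.1 ^ 3 - x.2 ^ 2)), p : ℕ) : ℝ) < Y ^ (1 / 6 : ℝ))} : ℝ) ≤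
        C * X ^ ε * (X * Y ^ (-(1 / 6 : ℝ)) + 1) := by
  sorry

/-- **STUB 5 · `stub_hallRegime`** (the ARCHIMEDEAN CORNER; XL; open; signature = gen 1's registered one). On
`{|u³ − v²| ≤ 1728·Y^{1/2}}` the dyadic floor forces `|u|³ > Y/2`, `u > 0`, `v = ±⌊u^{3/2}⌉ + k` with `|k| < 2445`: the
regime has `≍ Y^{1/3}` members before the conductor condition, and the content is that only `≪ X^{1+ε}Y^{-1/6}` of them
have `N*(u³ − v²) ≤ X` — radical-smallness (`Prob ≍ Y^{1/s − 1/2}`, exactly the random-model factor) of the values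
`D_k(u) = u³ − (⌊u^{3/2}⌉+k)² ≈ 2k·u^{3/2}`, `|D_k| ≲ Y^{1/2}`, of a NON-polynomial near-cusp form along `u ≍ Y^{1/3}`,
below the square-root barrier `Y^{1/6}` of one-variable methods for `Y > X³` (card item 7; TRIAGE-r1-2 "one hard corner,
five names"). Candidate levers: the substitution `u = w² + k'` (the archimedean place acquires the conductor `w = √u`,
`D` becomes `w³(3k'w − 2j) + …`, bilinear in `(k', j)·w`, and the count re-enters the dispersion framework with modulus
`w`), crux idea `three-descent-quadratic-roots` (`λ = 0` principal slice provable), Huxley/Bombieri–Pila above the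
barrier. Why the STATEMENT might fail: only with C⁺′; Danilov/Hall families (`|u³−v²| ≍ u^{1/2}`) give `O(log Y)`,
cusp-point twists are excluded (`u³ ≠ v²`) or charged `d²`. -/
theorem stub_hallRegime :
    ∀ σ : ℝ, 6 < σ → ∀ ε : ℝ, 0 < ε → ∃ C : ℝ, ∀ X Y : ℝ, 1 ≤ X → 1 ≤ Y → X ^ 3 ≤ 8 * Y → Y ≤ X ^ σ →
      (Set.ncard {x : ℤ × ℤ | (x.1 ≠ 0 ∧ x.2 ≠ 0 ∧ x.1 ^ 3 ≠ x.2 ^ 2 ∧ (1728 : ℤ) ∣ x.1 ^ 3 - x.2 ^ 2 ∧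
          ((∀ p : ℕ, p.Prime → 5 ≤ p → ¬ ((p : ℤ) ^ 4 ∣ x.1 ∧ (p : ℤ) ^ 6 ∣ x.2)) ∧
            ¬ ((2 : ℤ) ^ 8 ∣ x.1 ∧ (2 : ℤ) ^ 11 ∣ x.2) ∧ ¬ ((3 : ℤ) ^ 5 ∣ x.1 ∧ (3 : ℤ) ^ 9 ∣ x.2)) ∧
          ((|x.1| ^ 3 : ℤ) : ℝ) ≤ Y ∧ ((|x.1 ^ 3 - x.2 ^ 2| : ℤ) : ℝ) ≤ 1728 * Y ∧
          Y < 2 * max (((|x.1| ^ 3 : ℤ) : ℝ)) (((|x.1 ^ 3 - x.2 ^ 2| : ℤ) : ℝ) / 1728) ∧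
          ((∏ p ∈ ((x.1 ^ 3 - x.2 ^ 2) / 1728).natAbs.primeFactors,
              (if ((p : ℕ) : ℤ) ∣ x.1 then p ^ 2 else p) : ℕ) : ℝ) ≤ X) ∧
        ((|x.1 ^ 3 - x.2 ^ 2| : ℤ) : ℝ) ≤ 1728 * Y ^ (1 / 2 : ℝ)} : ℝ) ≤
        C * X ^ ε * (X * Y ^ (-(1 / 6 : ℝ)) + 1) := by
  sorry

/-! ### Consistency: each named statement IS its registered stub (definitionally) -/

theorem cuspTransfer_holds : CuspTransfer := stub_cuspTransfer
theorem cuspStationaryPhase_holds : CuspStationaryPhase := stub_cuspStationaryPhase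
theorem resolvedRegimeLaw_holds : ResolvedRegimeLaw := stub_resolvedRegime
theorem deepRegimeLaw_holds : DeepRegimeLaw := stub_deepRegime
theorem hallRegimeLaw_holds : HallRegimeLaw := stub_hallRegime

/-! ### Name-keyed aliases of the five statements (the hypotheses of the composition) -/
namespace Registered

/-- Alias of `CuspTransfer` keyed by the registered stub name. -/
abbrev stub_cuspTransfer : Prop := CuspTransfer
/-- Alias of `CuspStationaryPhase` keyed by the registered stub name. -/
abbrev stub_cuspStationaryPhase : Prop := CuspStationaryPhase
/-- Alias of `ResolvedRegimeLaw` keyed by the registered stub name. -/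
abbrev stub_resolvedRegime : Prop := ResolvedRegimeLaw
/-- Alias of `DeepRegimeLaw` keyed by the registered stub name. -/
abbrev stub_deepRegime : Prop := DeepRegimeLaw
/-- Alias of `HallRegimeLaw` keyed by the registered stub name. -/
abbrev stub_hallRegime : Prop := HallRegimeLaw

end Registered

/-! ## Entry lemmas of the lever (proved) -/

/-- The cusp parametrisation: for `e ∣ u³ − v²` with `gcd(u, e) = 1` the pair `(u,v)` lies on the parametrised
cuspidal cubic mod `e`, `u ≡ t², v ≡ t³` with `t = v·u⁻¹` (Tate: `E₄ ≡ 1, E₆ ≡ 1 mod q`). [gen 1 / `Ideator2Sketch`] -/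
theorem cuspParam (u v e : ℤ) (hcop : IsCoprime u e) (hdvd : e ∣ u ^ 3 - v ^ 2) :
    ∃ t : ℤ, t ^ 2 ≡ u [ZMOD e] ∧ t ^ 3 ≡ v [ZMOD e] := by
  obtain ⟨a, b, hab⟩ := hcop
  have h' : e ∣ v ^ 2 - u ^ 3 := by
    rw [show v ^ 2 - u ^ 3 = -(u ^ 3 - v ^ 2) by ring]; exact dvd_neg.mpr hdvd
  refine ⟨v * a, ?_, ?_⟩
  · have h1 : (v * a) ^ 2 - u = (v ^ 2 - u ^ 3) * a ^ 2 - u * b * e * (u * a + 1) := by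
      linear_combination (u * (u * a + 1)) * hab
    refine (Int.modEq_iff_dvd.mpr ?_).symm
    rw [h1]
    exact dvd_sub (h'.mul_right _) ⟨u * b * (u * a + 1), by ring⟩
  · have h2 : (v * a) ^ 3 - v
        = (v ^ 2 - u ^ 3) * v * a ^ 3 - v * b * e * ((u * a) ^ 2 + u * a + 1) := by
      linear_combination (v * ((u * a) ^ 2 + u * a + 1)) * hab
    refine (Int.modEq_iff_dvd.mpr ?_).symm
    rw [h2]
    exact dvd_sub ((h'.mul_right _).mul_right _) ⟨v * b * ((u * a) ^ 2 + u * a + 1), by ring⟩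

/-- A prime dividing `u³ − v²` exactly once, when `1728 ∣ u³ − v²`, is `≥ 5` … more precisely it is not `2` or `3`
(both divide `1728 = 2⁶3³` to at least the second power). -/
lemma simple_prime_ne_two_three {D : ℤ} (h1728 : (1728 : ℤ) ∣ D) {p : ℕ} (hp : p.Prime) (hpD : (p : ℤ) ∣ D)
    (hsimple : ¬ ((p : ℤ) ^ 2 ∣ D)) : p ≠ 2 ∧ p ≠ 3 := by
  constructor
  · rintro rfl
    exact hsimple (dvd_trans ⟨432, by norm_num⟩ h1728)
  · rintro rfl
    exact hsimple (dvd_trans ⟨192, by norm_num⟩ h1728)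

/-- **`r' ≤ N*`**: the simple radical divides into the conductor proxy — every prime `p ∥ u³ − v²` (with
`1728 ∣ u³ − v² ≠ 0`) is `≠ 2, 3`, divides `Δ = (u³−v²)/1728`, and is charged `p` or `p²` in `N*`. Consequence (with
`N* ≤ X ≤ 2Y^{1/3}` on the range `X³ ≤ 8Y`): `r' ≤ 2Y^{1/3}`, so the gen-1 "trivial regime" `r' ≥ Y^{1/2}` is empty for
`Y > 64`. -/
theorem simpleRad_le_Nstar (x : ℤ × ℤ) (hD : x.1 ^ 3 - x.2 ^ 2 ≠ 0) (h1728 : (1728 : ℤ) ∣ x.1 ^ 3 - x.2 ^ 2) :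
    simpleRad x ≤ Nstar x := by
  unfold simpleRad Nstar
  set D : ℤ := x.1 ^ 3 - x.2 ^ 2 with hDdef
  obtain ⟨Δ, hΔ⟩ := h1728
  have hΔ' : D / 1728 = Δ := by rw [hΔ]; simp
  have hΔne : Δ ≠ 0 := by
    rintro rfl; exact hD (by rw [hΔ]; simp)
  -- the simple primes form a subset of the prime factors of Δ
  have hsub : (D.natAbs.primeFactors.filter (fun p : ℕ => ¬ (((p : ℕ) : ℤ) ^ 2 ∣ D))) ⊆ Δ.natAbs.primeFactors := by
    intro p hp
    rw [Finset.mem_filter] at hp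
    obtain ⟨hpD, hsimple⟩ := hp
    have hpP : p.Prime := Nat.prime_of_mem_primeFactors hpD
    have hpdvdD : (p : ℤ) ∣ D := by
      have := Nat.dvd_of_mem_primeFactors hpD
      exact Int.ofNat_dvd_left.mpr this
    obtain ⟨hp2, hp3⟩ := simple_prime_ne_two_three ⟨Δ, hΔ⟩ hpP hpdvdD hsimple
    -- p ∣ 1728 * Δ and p coprime to 1728 ⇒ p ∣ Δ
    have hcop : IsCoprime (p : ℤ) 1728 := by
      have h2 : ¬ (p ∣ 2) := fun h => hp2 ((Nat.prime_dvd_prime_iff_eq hpP Nat.prime_two).mp h)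
      have h3 : ¬ (p ∣ 3) := fun h => hp3 ((Nat.prime_dvd_prime_iff_eq hpP Nat.prime_three).mp h)
      have hc2 : Nat.Coprime p 2 := (Nat.coprime_primes hpP Nat.prime_two).mpr (by
        rintro rfl; exact hp2 rfl)
      have hc3 : Nat.Coprime p 3 := (Nat.coprime_primes hpP Nat.prime_three).mpr (by
        rintro rfl; exact hp3 rfl)
      have : Nat.Coprime p 1728 := by
        have h1728 : (1728 : ℕ) = 2 ^ 6 * 3 ^ 3 := by norm_num
        rw [h1728]
        exact Nat.Coprime.mul_right (Nat.Coprime.pow_right _ hc2) (Nat.Coprime.pow_right _ hc3)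
      exact Int.isCoprime_iff_gcd_eq_one.mpr (by exact_mod_cast this)
    have hpΔ : (p : ℤ) ∣ Δ := by
      rw [hΔ] at hpdvdD
      exact hcop.dvd_of_dvd_mul_left hpdvdD
    have hpΔ' : p ∣ Δ.natAbs := Int.ofNat_dvd_left.mp hpΔ
    exact Nat.mem_primeFactors.mpr ⟨hpP, hpΔ', Int.natAbs_ne_zero.mpr hΔne⟩
  rw [hΔ']
  calc ∏ p ∈ D.natAbs.primeFactors.filter (fun p : ℕ => ¬ (((p : ℕ) : ℤ) ^ 2 ∣ D)), p
      ≤ ∏ p ∈ Δ.natAbs.primeFactors, p := by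
        apply Finset.prod_le_prod_of_subset_of_one_le' hsub
        intro p hp _
        exact (Nat.prime_of_mem_primeFactors hp).one_lt.le
    _ ≤ ∏ p ∈ Δ.natAbs.primeFactors, (if ((p : ℕ) : ℤ) ∣ x.1 then p ^ 2 else p) := by
        apply Finset.prod_le_prod' (fun p hp => ?_)
        have h1 : 1 ≤ p := (Nat.prime_of_mem_primeFactors hp).one_lt.le
        split_ifs
        · calc p = p ^ 1 := (pow_one p).symm
            _ ≤ p ^ 2 := Nat.pow_le_pow_right h1 (by norm_num)
        · exact le_rfl

/-- On the range `X³ ≤ 8Y` of the law, `X ≤ 2·Y^{1/3}`. -/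
lemma X_le_two_rpow_third {X Y : ℝ} (hX : 1 ≤ X) (hY : 1 ≤ Y) (hXY : X ^ 3 ≤ 8 * Y) :
    X ≤ 2 * Y ^ (1 / 3 : ℝ) := by
  have hX0 : 0 ≤ X := by linarith
  have hY0 : 0 ≤ Y := by linarith
  have h13 : (1 / 3 : ℝ) = ((3 : ℕ) : ℝ)⁻¹ := by norm_num
  have h1 : (X ^ 3) ^ (1 / 3 : ℝ) = X := by
    rw [h13]; exact Real.pow_rpow_inv_natCast hX0 (by norm_num)
  have h2 : (X ^ 3) ^ (1 / 3 : ℝ) ≤ (8 * Y) ^ (1 / 3 : ℝ) :=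
    Real.rpow_le_rpow (by positivity) hXY (by norm_num)
  have h3 : (8 * Y) ^ (1 / 3 : ℝ) = 2 * Y ^ (1 / 3 : ℝ) := by
    rw [Real.mul_rpow (by norm_num) hY0]
    congr 1
    rw [show (8 : ℝ) = (2 : ℝ) ^ 3 by norm_num, h13]
    exact Real.pow_rpow_inv_natCast (by norm_num) (by norm_num)
  linarith [h1 ▸ h2, h3]

/-- For `Y > 64`, `2·Y^{1/3} < Y^{1/2}`. -/
lemma two_rpow_third_lt_sqrt {Y : ℝ} (hY : 64 < Y) : 2 * Y ^ (1 / 3 : ℝ) < Y ^ (1 / 2 : ℝ) := by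
  have hY0 : 0 < Y := by linarith
  have hsplit : Y ^ (1 / 2 : ℝ) = Y ^ (1 / 3 : ℝ) * Y ^ (1 / 6 : ℝ) := by
    rw [← Real.rpow_add hY0]; norm_num
  have h16 : (1 / 6 : ℝ) = ((6 : ℕ) : ℝ)⁻¹ := by norm_num
  have h64 : (64 : ℝ) ^ (1 / 6 : ℝ) = 2 := by
    rw [show (64 : ℝ) = (2 : ℝ) ^ 6 by norm_num, h16]
    exact Real.pow_rpow_inv_natCast (by norm_num) (by norm_num)
  have h2 : (2 : ℝ) < Y ^ (1 / 6 : ℝ) := by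
    rw [← h64]
    exact Real.rpow_lt_rpow (by norm_num) hY (by norm_num)
  have h3 : 0 < Y ^ (1 / 3 : ℝ) := Real.rpow_pos_of_pos hY0 _
  rw [hsplit]
  nlinarith [h2, h3]

/-- **The gen-1 "trivial regime" is empty**: on the range of the law (`X³ ≤ 8Y`) and for `Y > 64`, every point of the
dyadic cusp set has simple radical `< Y^{1/2}` (indeed `≤ 2Y^{1/3}`), because `r' ≤ N* ≤ X ≤ 2Y^{1/3}`. -/
theorem trivialRegime_empty {X Y : ℝ} (hX : 1 ≤ X) (hY : 64 < Y) (hXY : X ^ 3 ≤ 8 * Y) {x : ℤ × ℤ}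
    (hx : x ∈ cuspSetD X Y) : (simpleRad x : ℝ) < Y ^ (1 / 2 : ℝ) := by
  obtain ⟨-, -, hne, h1728, -, -, -, -, hN⟩ := hx
  have hr : (simpleRad x : ℝ) ≤ (Nstar x : ℝ) := by
    exact_mod_cast simpleRad_le_Nstar x (sub_ne_zero.mpr hne) h1728
  have hY1 : (1 : ℝ) ≤ Y := by linarith
  calc (simpleRad x : ℝ) ≤ Nstar x := hr
    _ ≤ X := hN
    _ ≤ 2 * Y ^ (1 / 3 : ℝ) := X_le_two_rpow_third hX hY1 hXY
    _ < Y ^ (1 / 2 : ℝ) := two_rpow_third_lt_sqrt hY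

/-! ## Glue (kernel-checked; no `sorry` below this line): finiteness, union bound, cover, composition -/

section Glue

lemma abs_le_of_cube_le {x T : ℝ} (hT : 1 ≤ T) (h : |x| ^ 3 ≤ T) : |x| ≤ T := by
  rcases le_or_gt |x| 1 with h1 | h1
  · exact h1.trans hT
  · have h2 : 0 ≤ |x| * (|x| ^ 2 - 1) := mul_nonneg (abs_nonneg _) (by nlinarith)
    nlinarith [h2]

lemma abs_le_of_sq_le {y T : ℝ} (hT : 1 ≤ T) (h : y ^ 2 ≤ T) : |y| ≤ T := by
  rcases le_or_gt |y| 1 with h1 | h1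
  · exact h1.trans hT
  · have h2 : 0 ≤ |y| * (|y| - 1) := mul_nonneg (abs_nonneg _) (by linarith)
    have h3 : |y| ^ 2 = y ^ 2 := sq_abs y
    nlinarith [h2, h3]

/-- The dyadic cusp set is finite (`|u| ≤ |u|³ ≤ Y`, `v² ≤ |u|³ + |u³ − v²| ≤ 1729Y`). -/
theorem cuspSetD_finite (X Y : ℝ) (hY : 1 ≤ Y) : (cuspSetD X Y).Finite := by
  have hY' : (1 : ℝ) ≤ 1729 * Y := by linarith
  set N : ℕ := Nat.ceil (1729 * Y) with hN
  have hYN : 1729 * Y ≤ N := Nat.le_ceil _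
  refine (Set.Finite.prod (Set.finite_Icc (-(N : ℤ)) N) (Set.finite_Icc (-(N : ℤ)) N)).subset ?_
  rintro ⟨x, y⟩ ⟨-, -, -, -, -, hx, hxy, -, -⟩
  simp only [Set.mem_prod, Set.mem_Icc]
  have h3 : (((|x| ^ 3 : ℤ)) : ℝ) = |(x : ℝ)| ^ 3 := by push_cast; rfl
  have h4 : |(x : ℝ)| ^ 3 ≤ Y := h3 ▸ hx
  have hx1 : |(x : ℝ)| ^ 3 ≤ 1729 * Y := by
    have h0 : 0 ≤ Y := by linarith
    linarith
  have hx' : |(x : ℝ)| ≤ N := (abs_le_of_cube_le hY' hx1).trans hYN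
  have hy1 : (y : ℝ) ^ 2 ≤ 1729 * Y := by
    have e : (((|x ^ 3 - y ^ 2| : ℤ)) : ℝ) = |(x : ℝ) ^ 3 - (y : ℝ) ^ 2| := by push_cast; rfl
    have h1 : |(x : ℝ) ^ 3 - (y : ℝ) ^ 2| ≤ 1728 * Y := e ▸ hxy
    have h2 : (x : ℝ) ^ 3 ≤ |(x : ℝ)| ^ 3 := by
      rw [← abs_pow]; exact le_abs_self _
    have h5 := (abs_le.mp h1).1
    nlinarith
  have hy' : |(y : ℝ)| ≤ N := (abs_le_of_sq_le hY' hy1).trans hYN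
  have hx'' : |x| ≤ (N : ℤ) := by exact_mod_cast hx'
  have hy'' : |y| ≤ (N : ℤ) := by exact_mod_cast hy'
  exact ⟨⟨(abs_le.mp hx'').1, (abs_le.mp hx'').2⟩, ⟨(abs_le.mp hy'').1, (abs_le.mp hy'').2⟩⟩

/-- Any regime subset of the cusp set is finite. -/
theorem sepSet_finite (P : ℝ → ℤ × ℤ → Prop) (X Y : ℝ) (hY : 1 ≤ Y) :
    {x : ℤ × ℤ | x ∈ cuspSetD X Y ∧ P Y x}.Finite :=
  (cuspSetD_finite X Y hY).subset fun _ hx => hx.1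

/-- The right side of the law is nonnegative for `X, Y ≥ 1` once the constant is. -/
theorem bound_nonneg {X Y ε : ℝ} (hX : 1 ≤ X) (hY : 1 ≤ Y) :
    0 ≤ X ^ ε * (X * Y ^ (-(1 / 6 : ℝ)) + 1) := by
  have hX0 : 0 ≤ X := by linarith
  have hY0 : 0 ≤ Y := by linarith
  exact mul_nonneg (Real.rpow_nonneg hX0 _)
    (add_nonneg (mul_nonneg hX0 (Real.rpow_nonneg hY0 _)) zero_le_one)

/-- Monotonicity of the restricted law in the predicate. -/
theorem lawOn_mono {P Q : ℝ → ℤ × ℤ → Prop} (hPQ : ∀ Y x, P Y x → Q Y x) (hQ : LawOn Q) : LawOn P := by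
  intro σ hσ ε hε
  obtain ⟨C, hC⟩ := hQ σ hσ ε hε
  refine ⟨C, fun X Y hX hY hXY hYX => le_trans ?_ (hC X Y hX hY hXY hYX)⟩
  have hsub : {x : ℤ × ℤ | x ∈ cuspSetD X Y ∧ P Y x} ⊆ {x : ℤ × ℤ | x ∈ cuspSetD X Y ∧ Q Y x} :=
    fun x hx => ⟨hx.1, hPQ Y x hx.2⟩
  exact_mod_cast Set.ncard_le_ncard hsub (sepSet_finite Q X Y hY)

/-- Union bound: the law on `P` and on `Q` gives the law on `P ∨ Q` (constants `max C₁ 0 + max C₂ 0`). -/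
theorem lawOn_or {P Q : ℝ → ℤ × ℤ → Prop} (hP : LawOn P) (hQ : LawOn Q) :
    LawOn (fun Y x => P Y x ∨ Q Y x) := by
  intro σ hσ ε hε
  obtain ⟨C₁, h₁⟩ := hP σ hσ ε hε
  obtain ⟨C₂, h₂⟩ := hQ σ hσ ε hε
  refine ⟨max C₁ 0 + max C₂ 0, fun X Y hX hY hXY hYX => ?_⟩
  have hB := bound_nonneg (ε := ε) hX hY
  set B : ℝ := X ^ ε * (X * Y ^ (-(1 / 6 : ℝ)) + 1) with hBdef
  have hsub : {x : ℤ × ℤ | x ∈ cuspSetD X Y ∧ (P Y x ∨ Q Y x)} ⊆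
      {x : ℤ × ℤ | x ∈ cuspSetD X Y ∧ P Y x} ∪ {x : ℤ × ℤ | x ∈ cuspSetD X Y ∧ Q Y x} := by
    rintro x ⟨hx, hp | hq⟩
    · exact Or.inl ⟨hx, hp⟩
    · exact Or.inr ⟨hx, hq⟩
  have hfin : ({x : ℤ × ℤ | x ∈ cuspSetD X Y ∧ P Y x} ∪ {x : ℤ × ℤ | x ∈ cuspSetD X Y ∧ Q Y x}).Finite :=
    (sepSet_finite P X Y hY).union (sepSet_finite Q X Y hY)
  have hc1 := Set.ncard_le_ncard hsub hfin
  have hc2 := Set.ncard_union_le {x : ℤ × ℤ | x ∈ cuspSetD X Y ∧ P Y x}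
    {x : ℤ × ℤ | x ∈ cuspSetD X Y ∧ Q Y x}
  have hc3 : (Set.ncard {x : ℤ × ℤ | x ∈ cuspSetD X Y ∧ (P Y x ∨ Q Y x)} : ℝ) ≤
      (Set.ncard {x : ℤ × ℤ | x ∈ cuspSetD X Y ∧ P Y x} : ℝ) +
        (Set.ncard {x : ℤ × ℤ | x ∈ cuspSetD X Y ∧ Q Y x} : ℝ) := by
    exact_mod_cast hc1.trans hc2
  have hP' : (Set.ncard {x : ℤ × ℤ | x ∈ cuspSetD X Y ∧ P Y x} : ℝ) ≤ max C₁ 0 * B := by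
    calc (Set.ncard {x : ℤ × ℤ | x ∈ cuspSetD X Y ∧ P Y x} : ℝ) ≤ C₁ * B := by
          have h := h₁ X Y hX hY hXY hYX
          rw [hBdef, ← mul_assoc]; exact h
      _ ≤ max C₁ 0 * B := mul_le_mul_of_nonneg_right (le_max_left _ _) hB
  have hQ' : (Set.ncard {x : ℤ × ℤ | x ∈ cuspSetD X Y ∧ Q Y x} : ℝ) ≤ max C₂ 0 * B := by
    calc (Set.ncard {x : ℤ × ℤ | x ∈ cuspSetD X Y ∧ Q Y x} : ℝ) ≤ C₂ * B := by
          have h := h₂ X Y hX hY hXY hYX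
          rw [hBdef, ← mul_assoc]; exact h
      _ ≤ max C₂ 0 * B := mul_le_mul_of_nonneg_right (le_max_left _ _) hB
  calc (Set.ncard {x : ℤ × ℤ | x ∈ cuspSetD X Y ∧ (P Y x ∨ Q Y x)} : ℝ)
      ≤ max C₁ 0 * B + max C₂ 0 * B := hc3.trans (add_le_add hP' hQ')
    _ = (max C₁ 0 + max C₂ 0) * X ^ ε * (X * Y ^ (-(1 / 6 : ℝ)) + 1) := by rw [hBdef]; ring

/-- The three regimes cover every pair (pure case analysis on the two real thresholds). -/
theorem regimes_cover (Y : ℝ) (x : ℤ × ℤ) :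
    (ResolvedRegime Y x ∨ DeepRegime Y x) ∨ HallRegime Y x := by
  by_cases hH : HallRegime Y x
  · exact Or.inr hH
  · have hH' : ¬ (((|x.1 ^ 3 - x.2 ^ 2| : ℤ) : ℝ) ≤ 1728 * Y ^ (1 / 2 : ℝ)) := hH
    rcases le_or_gt (Y ^ (1 / 6 : ℝ)) (simpleRad x : ℝ) with h6 | h6
    · exact Or.inl (Or.inl ⟨hH', h6⟩)
    · exact Or.inl (Or.inr ⟨hH', h6⟩)

/-- The law on all pairs (predicate `True`) is C⁺′. -/
theorem cuspLawD_of_lawOn_true (h : LawOn fun _ _ => True) : CuspLawD := by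
  intro σ hσ ε hε
  obtain ⟨C, hC⟩ := h σ hσ ε hε
  refine ⟨C, fun X Y hX hY hXY hYX => ?_⟩
  have hset : {x : ℤ × ℤ | x ∈ cuspSetD X Y ∧ True} = cuspSetD X Y := by
    ext x; simp
  have h1 := hC X Y hX hY hXY hYX
  rw [hset] at h1
  exact h1

/-- **C⁺′ from the three regime laws** (union bound over the cover). -/
theorem cuspLawD_of_regimes (h3 : LawOn ResolvedRegime) (h4 : LawOn DeepRegime) (h5 : LawOn HallRegime) :
    CuspLawD := by
  have h34 : LawOn (fun Y x => ResolvedRegime Y x ∨ DeepRegime Y x) := lawOn_or h3 h4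
  have hall : LawOn (fun Y x => (ResolvedRegime Y x ∨ DeepRegime Y x) ∨ HallRegime Y x) := lawOn_or h34 h5
  exact cuspLawD_of_lawOn_true (lawOn_mono (fun Y x _ => regimes_cover Y x) hall)

end Glue

/-! ## The composition: the five stubs imply the crux, BY NAME -/

/-- **`SharpModerateLaw_of`** — the glue of the line (pure logic over the kernel-checked union bound; no `sorry`):
STUB 2 feeds STUBS 3–4, which with STUB 5 give C⁺′ on the three regimes, which cover; STUB 1 transfers C⁺′ to the crux. -/
theorem SharpModerateLaw_of (h1 : Registered.stub_cuspTransfer) (h2 : Registered.stub_cuspStationaryPhase)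
    (h3 : Registered.stub_resolvedRegime) (h4 : Registered.stub_deepRegime)
    (h5 : Registered.stub_hallRegime) :
    Summit.ABC.ABC.Theses.TwistAmplification.SharpModerateLaw :=
  h1 (cuspLawD_of_regimes (h3 h2) (h4 h2) h5)

/-- **`SharpModerateLaw_closed`** — the same composition as a CLOSED term (audit class `proof-of-item` modulo the
five `stub_*` sorries): the registered stubs feed `SharpModerateLaw_of` as stated (the verbatim restatements are
definitionally the named statements). When all five stubs land, this theorem is the sorry-free proof to propose
`--workitem stmt-ABC-1975`. -/
theorem SharpModerateLaw_closed : Summit.ABC.ABC.Theses.TwistAmplification.SharpModerateLaw :=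
  SharpModerateLaw_of stub_cuspTransfer stub_cuspStationaryPhase stub_resolvedRegime stub_deepRegime
    stub_hallRegime

end Summit.ABC.ABC.Cruxes.SharpModerateLaw.DeepModuliCuspDispersion
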